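import Literature.Analysis.FunctionSpaces.FourStepMomentFunctionalEquation
import HarnessLib

/-!
# The double pole of `W₄` at `s = −2`

[BorweinEtAl2012, §6 Example 5, eq. (w4coeff)]: "In the presence of double poles, as for `W₄`,
`lim_{s → −2} (s+2)² W₄(s) = (3 + 4W₄′(0) − W₄′(2))/8`" — obtained "using the functional equation
… and L'Hôpital's rule". Here `W₄` beyond its half-plane of holomorphy `Re s > −3/2` (the tree's
`Literature.Analysis.FunctionSpaces.W4`, `differentiableAt_W4`) MEANS its meromorphic continuation
by the functional equation `(s+4)³W₄(s+4) − 4(s+3)(5s²+30s+48)W₄(s+2) + 64(s+2)³W₄(s) = 0`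
(`W4_functionalEquation`), i.e.

  `W₄⁽¹⁾(s) := (4(s+3)(5s²+30s+48) W₄(s+2) − (s+4)³ W₄(s+4)) / (64 (s+2)³)`  (`W4ext`),

holomorphic on `Re s > −7/2` off `s = −2` and equal to `W₄` on `Re s > −3/2` (`W4ext_eq_W4`). The
numerator `N(s)` vanishes at `s = −2` (`W₄(0) = 1`, `W₄(2) = 4`), so the pole has order `≤ 2`, and
`(s+2)² W₄⁽¹⁾(s) = N(s)/(64(s+2)) → N′(−2)/64 = (24 + 32W₄′(0) − 8W₄′(2))/64`
(`tendsto_sq_mul_W4ext`), which is (w4coeff). Everything is proved; the values `W₄′(0) = 7ζ(3)/(2π²)`,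
`W₄′(2)` of [BorweinEtAl2012, §6] are NOT used or asserted.

## References

* [BorweinEtAl2012] J. M. Borwein, A. Straub, J. Wan, W. Zudilin, *Densities of short uniform random
  walks*, Canad. J. Math. 64 (2012), §6 Example 5, eq. (w4coeff); §4 Example 4 (the double pole
  of `W₄` at `−2`).
* J. M. Borwein, A. Straub, J. Wan, *Three-step and four-step random walk integrals*, Exp. Math. 22
  (2013) (the pole structure of `W₄`, [bsw-rw2] of the source).
-/

noncomputable section

open Complex Filter Topology
open Literature.Combinatorics.Enumerative (domb)

namespace Literature.Analysis.FunctionSpaces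

/-- **The continuation of `W₄` one strip to the left** by the functional equation:
`W₄⁽¹⁾(s) = (4(s+3)(5s²+30s+48)W₄(s+2) − (s+4)³W₄(s+4))/(64(s+2)³)`.
[cite: BorweinEtAl2012, §2 Ex. 1 and §6 Ex. 5] -/
def W4ext (s : ℂ) : ℂ :=
  (4 * (s + 3) * (5 * s ^ 2 + 30 * s + 48) * W4 (s + 2) - (s + 4) ^ 3 * W4 (s + 4)) /
    (64 * (s + 2) ^ 3)

/-- The numerator `N(s) = 4(s+3)(5s²+30s+48)W₄(s+2) − (s+4)³W₄(s+4)`. [folklore] -/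
def W4num (s : ℂ) : ℂ :=
  4 * (s + 3) * (5 * s ^ 2 + 30 * s + 48) * W4 (s + 2) - (s + 4) ^ 3 * W4 (s + 4)

/-- `W₄⁽¹⁾ = N/(64(s+2)³)`. [folklore] -/
theorem W4ext_eq_div (s : ℂ) : W4ext s = W4num s / (64 * (s + 2) ^ 3) := rfl

/-- **`W₄⁽¹⁾ = W₄` on `Re s > −3/2`** (the functional equation). [cite: BorweinEtAl2012, §2 Ex. 1] -/
theorem W4ext_eq_W4 {s : ℂ} (hs : -(3 / 2 : ℝ) < s.re) : W4ext s = W4 s := by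
  have hFE := W4_functionalEquation hs
  have hs2 : s + 2 ≠ 0 := by
    intro h
    have : s.re = -2 := by
      have := congrArg Complex.re h
      simp at this
      linarith
    linarith
  rw [W4ext, div_eq_iff (mul_ne_zero (by norm_num) (pow_ne_zero 3 hs2))]
  linear_combination (-1 : ℂ) * hFE

/-- `W₄(0) = 1`, `W₄(2) = 4`. [cite: BorweinEtAl2012, §1 eq. (1.1)] -/
theorem W4_zero_and_two : W4 0 = 1 ∧ W4 2 = 4 := by
  have h0 := W4_two_mul_natCast 0
  have h1 := W4_two_mul_natCast 1
  simp only [Nat.cast_zero, mul_zero] at h0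
  simp only [Nat.cast_one, mul_one] at h1
  rw [h0, h1, Literature.Combinatorics.Enumerative.domb_zero,
    Literature.Combinatorics.Enumerative.domb_one]
  norm_num

/-- The numerator vanishes at `s = −2`: `4·1·8·W₄(0) − 8·W₄(2) = 32 − 32 = 0`, so the pole of
`W₄⁽¹⁾` at `−2` has order at most `2`. [cite: BorweinEtAl2012, §4 Example 4] -/
theorem W4num_neg_two : W4num (-2) = 0 := by
  obtain ⟨h0, h2⟩ := W4_zero_and_two
  simp only [W4num]
  rw [show (-2 : ℂ) + 2 = 0 by norm_num, show (-2 : ℂ) + 4 = 2 by norm_num, h0, h2]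
  norm_num

/-- The numerator is differentiable at `−2` with
`N′(−2) = 24 + 32 W₄′(0) − 8 W₄′(2)`. [cite: BorweinEtAl2012, §6 Example 5] -/
theorem hasDerivAt_W4num_neg_two :
    HasDerivAt W4num (24 + 32 * deriv W4 0 - 8 * deriv W4 2) (-2) := by
  obtain ⟨h0, h2⟩ := W4_zero_and_two
  have hd0 : HasDerivAt W4 (deriv W4 0) ((-2 : ℂ) + 2) := by
    rw [show (-2 : ℂ) + 2 = 0 by norm_num]
    exact (differentiableAt_W4 (by norm_num)).hasDerivAt
  have hd2 : HasDerivAt W4 (deriv W4 2) ((-2 : ℂ) + 4) := by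
    rw [show (-2 : ℂ) + 4 = 2 by norm_num]
    exact (differentiableAt_W4 (by norm_num)).hasDerivAt
  have hA : HasDerivAt (fun s : ℂ => W4 (s + 2)) (deriv W4 0) (-2) := hd0.comp_add_const (-2) 2
  have hB : HasDerivAt (fun s : ℂ => W4 (s + 4)) (deriv W4 2) (-2) := hd2.comp_add_const (-2) 4
  have hid := hasDerivAt_id (-2 : ℂ)
  -- polynomial factors
  have hP1 : HasDerivAt (fun s : ℂ => 4 * (s + 3)) (4 * 1) (-2) := (hid.add_const 3).const_mul 4
  have hP2 : HasDerivAt (fun s : ℂ => 5 * s ^ 2 + 30 * s + 48) (5 * ((2 : ℕ) * (-2 : ℂ) ^ (2 - 1) * 1) +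
      30 * 1) (-2) := ((hid.fun_pow 2).const_mul 5 |>.add (hid.const_mul 30)).add_const 48
  have hP := hP1.fun_mul hP2
  have hQ : HasDerivAt (fun s : ℂ => (s + 4) ^ 3) ((3 : ℕ) * ((-2 : ℂ) + 4) ^ (3 - 1) * 1) (-2) :=
    (hid.add_const 4).fun_pow 3
  have hN := (hP.fun_mul hA).fun_sub (hQ.fun_mul hB)
  have hfun : W4num = fun s => 4 * (s + 3) * (5 * s ^ 2 + 30 * s + 48) * W4 (s + 2) -
      (s + 4) ^ 3 * W4 (s + 4) := rfl
  rw [hfun]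
  refine hN.congr_deriv ?_
  rw [show (-2 : ℂ) + 2 = 0 by norm_num, show (-2 : ℂ) + 4 = 2 by norm_num, h0, h2]
  push_cast
  ring

/-- **[BorweinEtAl2012, §6 Example 5, eq. (w4coeff)]: the double pole of `W₄` at `s = −2`**:
`lim_{s → −2} (s + 2)² W₄⁽¹⁾(s) = (3 + 4 W₄′(0) − W₄′(2))/8`, where `W₄⁽¹⁾` is the continuation of
`W₄` by its functional equation and `W₄′` the derivative of the (holomorphic) `W₄` at `0` and `2`.
[cite: BorweinEtAl2012, §6 Example 5 (w4coeff)] -/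
theorem tendsto_sq_mul_W4ext :
    Tendsto (fun s : ℂ => (s + 2) ^ 2 * W4ext s) (𝓝[≠] (-2))
      (𝓝 ((3 + 4 * deriv W4 0 - deriv W4 2) / 8)) := by
  -- `N(s)/(s+2) → N′(−2)`
  have hslope := hasDerivAt_iff_tendsto_slope.mp hasDerivAt_W4num_neg_two
  have hlim : (3 + 4 * deriv W4 0 - deriv W4 2) / 8 =
      (24 + 32 * deriv W4 0 - 8 * deriv W4 2) / 64 := by ring
  rw [hlim]
  refine ((hslope.div_const 64).congr' ?_)
  filter_upwards [self_mem_nhdsWithin] with s hs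
  have hs2 : s + 2 ≠ 0 := by
    intro h
    exact hs (show s = -2 by linear_combination h)
  rw [slope_def_field, W4num_neg_two, sub_zero, W4ext_eq_div, sub_neg_eq_add]
  field_simp

end Literature.Analysis.FunctionSpaces

end
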